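import Mathlib.Tactic
import HarnessLib
import HarnessLib.Audit.Tags
import Summits.CriticalPhenomena.PercolationContinuityZ3.Theorems.PercNearOneGluingNoHeavyLowerTailSahiAntichainSplitTwo

/-!
# Antichains: meets plus joins — the dual two-member step, and V5 unconditionally for at most five members

Support file (seat `prim-masterthm-p1`, gen 35; `--supports stmt-CriticalPhenomena-4575`).  No `sorry`, standard axioms.  Builds on `…SahiAntichainSplit`,
`…SahiAntichainSplitStep`, `…SahiAntichainSplitTwo`.  Memo `run/shared/lean/prim/prim-masterthm/FROM-prim-masterthm-p1-g35-SPLIT-STEP.md`.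

NEW HERE ([this work], gen 35).
* **The dual two-member step** (`two_le_newLabels_of_card_below_eq_two`): exactly two members avoid `r` (and at least two contain it) ⟹ `newLabels P r ≥ 2`.
* `two_le_newLabels_of_min_le_two`: at every effective point with `min(#above, #below) ≤ 2` the split creates at least two new labels.
* **V5 (`2 #P ≤ #meets P + #joins P + 2`) and V1 (`#P ≤ #meets + 1 ∨ #P ≤ #joins + 1`) hold UNCONDITIONALLY for every antichain with `#P ≤ 5`**
  (`two_mul_card_le_of_card_le_five`, `card_le_or_card_le_of_card_le_five`): every effective point of such a family has a side with at most two members.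
  (Data, memo §1: on `2^6` the split creates ≥ 2 new labels whenever `min(#above,#below) ≤ 7`, first failures at `min = 8`; at `n = 8` there are antichains
  with no good point at all, so local steps of this kind cannot reach all `N`.)
HONEST FRAMING: V5 in general remains OPEN; everything here is unconditional. [this work]
-/

namespace Summit.CriticalPhenomena.PercolationContinuityZ3.Theorems.SahiColouredDaykin

open Finset

variable {α : Type*} [DecidableEq α]

/-- **Two-member step (exactly two members avoid `r`)**, by the dual argument. [this work] -/
theorem two_le_newLabels_of_card_below_eq_two {P : Finset (Finset α)} {r : α}
    (hanti : IsAntichain (· ⊆ ·) (P : Set (Finset α))) (h2 : #(below P r) = 2) (hp : 2 ≤ #(above P r)) :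
    2 ≤ newLabels P r := by
  obtain ⟨b, b', hne, hB⟩ := card_eq_two.1 h2
  have hb : b ∈ below P r := by rw [hB]; simp
  have hb' : b' ∈ below P r := by rw [hB]; simp
  obtain ⟨hbP, hrb⟩ := mem_below_iff.1 hb
  obtain ⟨hb'P, hrb'⟩ := mem_below_iff.1 hb'
  unfold newLabels
  by_cases hcb : ∀ a ∈ above P r, ∀ a₂ ∈ above P r, a ∩ b = a₂ ∩ b
  · obtain ⟨a₀, ha₀⟩ : (above P r).Nonempty := card_pos.1 (by omega)
    have := card_above_le_card_newJoins_of_inter_const (Z := a₀ ∩ b) hanti hb (fun a ha => hcb a ha a₀ ha₀)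
    omega
  by_cases hcb' : ∀ a ∈ above P r, ∀ a₂ ∈ above P r, a ∩ b' = a₂ ∩ b'
  · obtain ⟨a₀, ha₀⟩ : (above P r).Nonempty := card_pos.1 (by omega)
    have := card_above_le_card_newJoins_of_inter_const (Z := a₀ ∩ b') hanti hb' (fun a ha => hcb' a ha a₀ ha₀)
    omega
  push Not at hcb hcb'
  obtain ⟨a₁, ha₁, a₂, ha₂, hne12⟩ := hcb
  have hM : meets (below P r) = {b ∩ b'} := by
    apply Subset.antisymm
    · intro Z hZ
      obtain ⟨c, hc, c', hc', hcc', hZe⟩ := mem_meets_iff.1 hZ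
      rw [hZe, mem_singleton]
      rw [hB, mem_insert, mem_singleton] at hc hc'
      rcases hc with h1 | h1 <;> rcases hc' with h2 | h2
      · exact absurd (h1.trans h2.symm) hcc'
      · rw [h1, h2]
      · rw [h1, h2, inter_comm]
      · exact absurd (h1.trans h2.symm) hcc'
    · intro Z hZ
      rw [mem_singleton.1 hZ]
      exact mem_meets_iff.2 ⟨b, hb, b', hb', hne, rfl⟩
  have hnewM : newMeets P r = crossMeets P r \ {b ∩ b'} := by unfold newMeets; rw [hM]
  have hX : ∀ {a c}, a ∈ above P r → c ∈ below P r → a ∩ c ∈ crossMeets P r := by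
    intro a c ha hc
    exact mem_crossMeets_iff.2 ⟨a, (mem_above_iff.1 ha).1, c, (mem_below_iff.1 hc).1, (mem_above_iff.1 ha).2, (mem_below_iff.1 hc).2, rfl⟩
  by_cases h3 : ∃ Z ∈ crossMeets P r, Z ≠ a₁ ∩ b ∧ Z ≠ a₂ ∩ b
  · obtain ⟨Z, hZ, hZ1, hZ2⟩ := h3
    have hsub : ({a₁ ∩ b, a₂ ∩ b, Z} : Finset (Finset α)) ⊆ crossMeets P r := by
      intro V hV
      simp only [mem_insert, mem_singleton] at hV
      rcases hV with rfl | rfl | rfl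
      · exact hX ha₁ hb
      · exact hX ha₂ hb
      · exact hZ
    have hc3 : #({a₁ ∩ b, a₂ ∩ b, Z} : Finset (Finset α)) = 3 := by
      rw [card_insert_of_notMem, card_pair (Ne.symm hZ2)]
      simp only [mem_insert, mem_singleton, not_or]
      exact ⟨hne12, Ne.symm hZ1⟩
    have h3le : 3 ≤ #(crossMeets P r) := hc3 ▸ card_le_card hsub
    have : 2 ≤ #(newMeets P r) := by
      rw [hnewM]
      have := le_card_sdiff ({b ∩ b'} : Finset (Finset α)) (crossMeets P r)
      rw [card_singleton] at this
      omega
    omega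
  · push Not at h3
    have hXeq : ∀ Z ∈ crossMeets P r, Z = a₁ ∩ b ∨ Z = a₂ ∩ b := by
      intro Z hZ
      by_cases h : Z = a₁ ∩ b
      · exact Or.inl h
      · exact Or.inr (h3 Z hZ h)
    by_cases hZ1 : a₁ ∩ b ≠ b ∩ b' ∧ a₂ ∩ b ≠ b ∩ b'
    · have hsub : ({a₁ ∩ b, a₂ ∩ b} : Finset (Finset α)) ⊆ newMeets P r := by
        rw [hnewM]
        intro V hV
        simp only [mem_insert, mem_singleton] at hV
        rcases hV with rfl | rfl
        · exact mem_sdiff.2 ⟨hX ha₁ hb, by rw [mem_singleton]; exact hZ1.1⟩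
        · exact mem_sdiff.2 ⟨hX ha₂ hb, by rw [mem_singleton]; exact hZ1.2⟩
      have := card_le_card hsub
      rw [card_pair hne12] at this
      omega
    · have hXb' : ∀ a ∈ above P r, a ∩ b' = a₁ ∩ b ∨ a ∩ b' = a₂ ∩ b := fun a ha => hXeq _ (hX ha hb')
      have hXb : ∀ a ∈ above P r, a ∩ b = a₁ ∩ b ∨ a ∩ b = a₂ ∩ b := fun a ha => hXeq _ (hX ha hb)
      have hone : a₁ ∩ b = b ∩ b' ∨ a₂ ∩ b = b ∩ b' := by
        by_contra h; push Not at h; exact hZ1 h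
      obtain ⟨c₁, hc₁, c₂, hc₂, hne'⟩ := hcb'
      -- both cross-meet values are contained in b' (each is some a ∩ b')
      have hval' : a₁ ∩ b ⊆ b' ∧ a₂ ∩ b ⊆ b' := by
        rcases hXb' c₁ hc₁ with h1 | h1 <;> rcases hXb' c₂ hc₂ with h2 | h2
        · exact absurd (h1.trans h2.symm) hne'
        · exact ⟨h1 ▸ inter_subset_right, h2 ▸ inter_subset_right⟩
        · exact ⟨h2 ▸ inter_subset_right, h1 ▸ inter_subset_right⟩
        · exact absurd (h1.trans h2.symm) hne'
      have hinf1 : a₁ ∩ b ⊆ b ∩ b' := subset_inter inter_subset_right hval'.1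
      have hinf2 : a₂ ∩ b ⊆ b ∩ b' := subset_inter inter_subset_right hval'.2
      -- (F0) a ∩ b = a ∩ b' for every a
      have hF0 : ∀ a ∈ above P r, a ∩ b = a ∩ b' := by
        intro a ha
        have h1 : a ∩ b ⊆ b' := by
          rcases hXb a ha with h | h
          · rw [h]; exact hval'.1
          · rw [h]; exact hval'.2
        have h2 : a ∩ b' ⊆ b := by
          rcases hXb' a ha with h | h
          · rw [h]; exact inter_subset_right
          · rw [h]; exact inter_subset_right
        exact Subset.antisymm (subset_inter inter_subset_left h1) (subset_inter inter_subset_left h2)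
      -- (F1) every a avoids b \ b'
      have hF1 : ∀ a ∈ above P r, ∀ x ∈ b \ b', x ∉ a := by
        intro a ha x hx hxa
        obtain ⟨hxb, hxb'⟩ := mem_sdiff.1 hx
        have : x ∈ a ∩ b' := by rw [← hF0 a ha]; exact mem_inter.2 ⟨hxa, hxb⟩
        exact hxb' (mem_inter.1 this).2
      -- (F2) injectivity of `a ↦ a ∪ b` on `above`
      have hF2 : Set.InjOn (fun a => a ∪ b) (above P r : Set (Finset α)) := by
        intro a ha a' ha' h
        simp only [mem_coe] at ha ha'
        by_contra haa
        have hi : a ∩ b ≠ a' ∩ b := by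
          intro hi
          apply haa
          have hi' : b ∩ a = b ∩ a' := by rw [inter_comm b a, inter_comm b a']; exact hi
          have hu' : b ∪ a = b ∪ a' := by rw [union_comm b a, union_comm b a']; exact h
          exact eq_of_inter_eq_of_union_eq hi' hu'
        -- general fact: a ∩ b ⊆ a' ∩ b and a ∪ b = a' ∪ b ⟹ a ⊆ a'
        have key : ∀ {a a' : Finset α}, a ∈ above P r → a' ∈ above P r → a ∪ b = a' ∪ b → a ∩ b ⊆ a' ∩ b → a = a' := by
          intro a a' ha ha' hu hsub
          have haa' : a ⊆ a' := by
            intro x hxa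
            by_cases hxb : x ∈ b
            · exact (mem_inter.1 (hsub (mem_inter.2 ⟨hxa, hxb⟩))).1
            · have : x ∈ a' ∪ b := by rw [← hu]; exact mem_union_left _ hxa
              rcases mem_union.1 this with hx | hx
              · exact hx
              · exact absurd hx hxb
          by_contra hne2
          exact hanti (mem_coe.2 (mem_above_iff.1 ha).1) (mem_coe.2 (mem_above_iff.1 ha').1) hne2 haa'
        rcases hone with h1 | h1
        · have hle : a₂ ∩ b ⊆ a₁ ∩ b := by rw [h1]; exact hinf2
          rcases hXb a ha with hb1 | hb2 <;> rcases hXb a' ha' with hb'1 | hb'2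
          · exact hi (hb1.trans hb'1.symm)
          · exact (Ne.symm haa) (key ha' ha h.symm (by rw [hb'2, hb1]; exact hle))
          · exact haa (key ha ha' h (by rw [hb2, hb'1]; exact hle))
          · exact hi (hb2.trans hb'2.symm)
        · have hle : a₁ ∩ b ⊆ a₂ ∩ b := by rw [h1]; exact hinf1
          rcases hXb a ha with hb1 | hb2 <;> rcases hXb a' ha' with hb'1 | hb'2
          · exact hi (hb1.trans hb'1.symm)
          · exact haa (key ha ha' h (by rw [hb1, hb'2]; exact hle))
          · exact (Ne.symm haa) (key ha' ha h.symm (by rw [hb'1, hb2]; exact hle))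
          · exact hi (hb2.trans hb'2.symm)
      have hsub : (above P r).image (fun a => a ∪ b) ⊆ newJoins P r := by
        intro W hW
        obtain ⟨a, ha, rfl⟩ := mem_image.1 hW
        obtain ⟨haP, hra⟩ := mem_above_iff.1 ha
        unfold newJoins
        refine mem_sdiff.2 ⟨mem_crossJoins_iff.2 ⟨a, haP, b, hbP, hra, hrb, rfl⟩, ?_⟩
        intro hold
        obtain ⟨c, hc, c', hc', _, he⟩ := mem_joins_iff.1 hold
        have hnb : ¬ b ⊆ b' := fun h => hanti (mem_coe.2 hbP) (mem_coe.2 hb'P) hne h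
        obtain ⟨x, hxb, hxb'⟩ := not_subset.1 hnb
        have hx : x ∈ b \ b' := mem_sdiff.2 ⟨hxb, hxb'⟩
        have : x ∈ c ∪ c' := by rw [← he]; exact mem_union_right _ hxb
        rcases mem_union.1 this with h | h
        · exact hF1 c hc x hx h
        · exact hF1 c' hc' x hx h
      have := card_le_card hsub
      rw [card_image_of_injOn hF2] at this
      omega

/-- **Every effective point with `min(#above, #below) ≤ 2` creates at least two new labels** (for antichains with `#P ≥ 2`). [this work] -/
theorem two_le_newLabels_of_min_le_two {P : Finset (Finset α)} {r : α}
    (hanti : IsAntichain (· ⊆ ·) (P : Set (Finset α))) (hA : (above P r).Nonempty) (hB : (below P r).Nonempty)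
    (hmin : #(above P r) ≤ 2 ∨ #(below P r) ≤ 2) : 2 ≤ newLabels P r := by
  have hcard := card_above_add_card_below P r
  have hApos : 0 < #(above P r) := card_pos.2 hA
  have hBpos : 0 < #(below P r) := card_pos.2 hB
  have h2 : 2 ≤ #P := by omega
  by_cases hA1 : #(above P r) = 1
  · exact two_le_newLabels_of_card_above_eq_one hanti h2 hA1
  by_cases hB1 : #(below P r) = 1
  · exact two_le_newLabels_of_card_below_eq_one hanti h2 hB1
  rcases hmin with h | h
  · exact two_le_newLabels_of_card_above_eq_two hanti (by omega) (by omega)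
  · exact two_le_newLabels_of_card_below_eq_two hanti (by omega) (by omega)

/-! ### 3. V5 and V1 unconditionally for at most five members -/

/-- **V5 holds unconditionally for antichains with at most five members**: every effective point has a side with at most two members. [this work] -/
theorem two_mul_card_le_of_card_le_five :
    ∀ P : Finset (Finset α), IsAntichain (· ⊆ ·) (P : Set (Finset α)) → #P ≤ 5 → 2 * #P ≤ #(meets P) + #(joins P) + 2 := by
  suffices H : ∀ n, ∀ P : Finset (Finset α), #P = n → #P ≤ 5 → IsAntichain (· ⊆ ·) (P : Set (Finset α)) →
      2 * #P ≤ #(meets P) + #(joins P) + 2 from fun P hP h5 => H _ P rfl h5 hP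
  intro n
  induction n using Nat.strong_induction_on with
  | _ n ih =>
    intro P hPn h5 hanti
    by_cases h2 : 2 ≤ #P
    · obtain ⟨r, hr⟩ := effPoints_nonempty h2
      obtain ⟨hA, hB⟩ := mem_effPoints_iff.1 hr
      have hcard := card_above_add_card_below P r
      have hApos : 0 < #(above P r) := card_pos.2 hA
      have hBpos : 0 < #(below P r) := card_pos.2 hB
      have hnew : 2 ≤ newLabels P r := two_le_newLabels_of_min_le_two hanti hA hB (by omega)
      have ihA := ih (#(above P r)) (by omega) (above P r) rfl (by omega) (isAntichain_above hanti r)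
      have ihB := ih (#(below P r)) (by omega) (below P r) rfl (by omega) (isAntichain_below hanti r)
      exact two_mul_card_le_step P r hnew ihA ihB
    · omega

/-- V1 for at most five members, unconditionally. [this work] -/
theorem card_le_or_card_le_of_card_le_five (P : Finset (Finset α)) (hanti : IsAntichain (· ⊆ ·) (P : Set (Finset α)))
    (h5 : #P ≤ 5) : #P ≤ #(meets P) + 1 ∨ #P ≤ #(joins P) + 1 :=
  card_le_or_card_le_of_two_mul_card_le (two_mul_card_le_of_card_le_five P hanti h5)

end Summit.CriticalPhenomena.PercolationContinuityZ3.Theorems.SahiColouredDaykin
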